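import Summits.NavierStokesRegularity.FluidComputer.PalasekTowerRegisterGlobalHalves

/-!
# REGISTER v2.3′: the silent window is dissipative — the energy budget of a continuation

Cell `ns-blowup`, seat `ns-blowup-ecbridge-5` (g0); companion of
`PalasekTowerRegisterGlobalHalves.lean` (silent-window uniqueness, the lossless BC3 split of
`EpisodeInductionG`). LABEL: E–C typing (KERNEL bookkeeping; every statement PROVED, no `Prop`
introduced, no named fact used). WHAT THIS IS NOT: not Navier–Stokes evidence — nothing is
constructed or asserted about regularity or blow-up.

## What is proved

* `kineticEnergy_le_of_silent_force`: a finite-energy classical solution on `[0, T]` whose force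
  vanishes from `t₁` on has NON-INCREASING energy on `[t₁, T]`: restarted at any `s ≥ t₁` it is an
  unforced finite-energy classical solution on a closed slab, hence Leray–Hopf from `u(s)` (Tao
  2013, Lemma 8.1 with Lemma 4.1 (i) — tree theorem `isLerayHopfOn_of_finiteEnergy`, all inputs
  discharged), and the energy inequality from `0` with zero force drops the dissipation.
* `Stage.continuation_kineticEnergy_le`, `Stage.kineticEnergy_readout_le`: for a QUIET schedule
  every finite-energy classical continuation of a stage — in particular the stage itself at every
  readout `τ_j`, `j ≥ 1` — has energy at most `½∫|u(τ₁)|²`. The registered floors `c₁ Y_j ↑ ∞`,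
  strain floors `c₁ A_j` and core circulations `N_j^{β-2}` at scale `1/N_j` of all later levels are
  therefore met on a FIXED energy budget, by concentration alone (the uniform energy bound that the
  limit step of any «no blow-up ⇐ no overshoot» argument for `ContinuationEnvelope` needs).

References: T. Tao, Anal. PDE 6 (2013), Lemma 8.1, Lemma 4.1 (i) [cite: Tao2011, Lemma 8.1];
S. Palasek, arXiv:2605.13827 §4 [cite: Palasek2026ElementaryModel, §4].
-/

noncomputable section

namespace Summit.NavierStokesRegularity.FluidComputer.PalasekTowerClayBridge

open Set MeasureTheory Filter Topology Function Real
open scoped ENNReal ContDiff NNReal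
open Literature.Analysis.FluidPDE

/-! ## The silent window is dissipative -/

/-- **Energy is non-increasing after the force falls silent (no named fact).** A finite-energy
classical solution on `[0, T]` whose force vanishes from `t₁` on has
`½∫|u(t)|² ≤ ½∫|u(s)|²` for all `t₁ ≤ s ≤ t ≤ T`: restarted at `s` it is an UNFORCED finite-energy
classical solution on a closed slab, hence Leray–Hopf from `u(s)` (Tao 2013, Lemma 8.1 with
Lemma 4.1 (i), tree theorem `isLerayHopfOn_of_finiteEnergy`), and the energy inequality from `0`
with zero force drops the dissipation. [cite: Tao2011, Lemma 8.1] -/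
theorem kineticEnergy_le_of_silent_force {ν t₁ T : ℝ} (hν : 0 < ν) (h1 : 0 ≤ t₁)
    {f u : ℝ → EuclideanSpace ℝ (Fin 3) → EuclideanSpace ℝ (Fin 3)}
    {p : ℝ → EuclideanSpace ℝ (Fin 3) → ℝ}
    (hf : ∀ t, t₁ ≤ t → f t = 0)
    (hu : IsClassicalNSSolutionOn (Icc 0 T) ν f u p)
    (hEu : ∃ C : ℝ≥0∞, C < ⊤ ∧ ∀ t ∈ Icc 0 T, ∫⁻ x, ‖u t x‖ₑ ^ 2 ≤ C)
    {s t : ℝ} (hs : t₁ ≤ s) (hst : s ≤ t) (htT : t ≤ T) :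
    VectorCalculus.kineticEnergy (u t) ≤ VectorCalculus.kineticEnergy (u s) := by
  rcases hst.eq_or_lt with rfl | hst'
  · exact le_rfl
  have hsT : s < T := lt_of_lt_of_le hst' htT
  have hU : IsClassicalNSSolutionOn (Icc 0 (T - s)) ν 0 (fun r => u (r + s)) (fun r => p (r + s)) :=
    isClassicalNSSolutionOn_translate_of_silent hu (h1.trans hs) hsT fun r hr => hf r (hs.trans hr)
  have hEU : ∃ C : ℝ≥0∞, C < ⊤ ∧ ∀ r ∈ Icc 0 (T - s), ∫⁻ x, ‖u (r + s) x‖ₑ ^ 2 ≤ C := by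
    obtain ⟨C, hC, hb⟩ := hEu
    exact ⟨C, hC, fun r hr => hb (r + s) ⟨by linarith [hr.1, h1.trans hs], by linarith [hr.2]⟩⟩
  obtain ⟨hLH, -⟩ := isLerayHopfOn_of_finiteEnergy hU hν (by linarith) hEU
  obtain ⟨G, -, -, hEG, -⟩ := hLH.weakGrad_energy
  have h := hEG (t - s) ⟨by linarith, by linarith⟩
  have hforce : ∫ τ in (0 : ℝ)..(t - s), ∫ x,
      inner ℝ ((0 : ℝ → EuclideanSpace ℝ (Fin 3) → EuclideanSpace ℝ (Fin 3)) τ x) (u (τ + s) x)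
        = 0 := by
    simp
  rw [hforce, add_zero] at h
  have hD : 0 ≤ ν * (∫⁻ τ in Ioo 0 (t - s), ∫⁻ x, ENNReal.ofReal (frobeniusNormSq (G τ x))).toReal :=
    mul_nonneg hν.le ENNReal.toReal_nonneg
  have h' : VectorCalculus.kineticEnergy (u (t - s + s)) ≤ VectorCalculus.kineticEnergy (u (0 + s)) := by
    linarith
  simpa only [sub_add_cancel, zero_add] using h'

namespace Stage

variable {ν : ℝ} {R : TowerRates} {S : Schedule R} {m : Margins R} {k : ℕ}

/-- **The silent tower runs on a fixed energy budget.** For a quiet schedule, `ν > 0`, a stage at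
level `k` (any rates, any margin), every finite-energy classical continuation `u` of the stage to
`[0, T']` satisfies `½∫|u(t)|² ≤ ½∫|u(τ₁)|² = ½∫|s.u(τ₁)|²` for `τ₁ ≤ t ≤ T'` (when `1 ≤ k`, so that
the continuation passes through the stage's state at `τ₁`): all later floors `c₁ Y_j ↑ ∞` must be
met by CONCENTRATION, never by energy input. [cite: Tao2011, Lemma 8.1] -/
theorem continuation_kineticEnergy_le (hν : 0 < ν) (hQ : S.Quiet) (hk : 1 ≤ k) (s : Stage ν R S m k)
    {T' : ℝ} {u : ℝ → EuclideanSpace ℝ (Fin 3) → EuclideanSpace ℝ (Fin 3)}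
    {p : ℝ → EuclideanSpace ℝ (Fin 3) → ℝ}
    (hu : IsClassicalNSSolutionOn (Icc 0 T') ν S.f u p)
    (hua : ∀ t ∈ Icc 0 (S.τ k), u t = s.u t)
    (hEu : ∃ C : ℝ≥0∞, C < ⊤ ∧ ∀ t ∈ Icc 0 T', ∫⁻ x, ‖u t x‖ₑ ^ 2 ≤ C)
    {t : ℝ} (ht1 : S.τ 1 ≤ t) (htT : t ≤ T') :
    VectorCalculus.kineticEnergy (u t) ≤ VectorCalculus.kineticEnergy (s.u (S.τ 1)) := by
  have h1k : S.τ 1 ≤ S.τ k := S.τ_mono hk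
  rw [← hua (S.τ 1) ⟨(S.τ_pos 1).le, h1k⟩]
  exact kineticEnergy_le_of_silent_force hν (S.τ_pos 1).le hQ hu hEu le_rfl ht1 htT

/-- In particular the stage's own energy at every readout `τ_j`, `1 ≤ j ≤ k`, is at most its energy
at `τ₁`. [cite: Tao2011, Lemma 8.1] -/
theorem kineticEnergy_readout_le (hν : 0 < ν) (hQ : S.Quiet) (s : Stage ν R S m k) {j : ℕ}
    (hj : 1 ≤ j) (hjk : j ≤ k) :
    VectorCalculus.kineticEnergy (s.u (S.τ j)) ≤ VectorCalculus.kineticEnergy (s.u (S.τ 1)) :=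
  s.continuation_kineticEnergy_le hν hQ (hj.trans hjk) s.classical (fun _ _ => rfl) s.energy
    (S.τ_mono hj) (S.τ_mono hjk)

end Stage

end Summit.NavierStokesRegularity.FluidComputer.PalasekTowerClayBridge

end
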